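import Literature.Probability.LatticeModels.PlaneRotatorMessagerMiracleSole
import Literature.Probability.LatticeModels.PlaneRotatorCorrelationLength
import Literature.Probability.LatticeModels.PlaneRotatorFreeTwoPointInvariance
import HarnessLib

/-!
# The two-point function of the 2D plane rotator: exponential decay OR the explicit power law
# `G_K(0, v) ≥ 1/(8‖v‖₁)` (van Engelenburg–Lis §6 without Fröhlich–Spencer), the axis sandwich
# `G_K(0, ‖x‖₁e₀) ≤ G_K(0, x) ≤ G_K(0, ‖x‖∞e₀)`, and `massGap = invCorrLength`

Topic `Literature/Probability/LatticeModels` (cell `pub/hubbard-tc`, D-0154 (1) block (D), literature seat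
`hub-tc-therm-lit-2`, lead ruling R124 (2), FILE 2; companion of `PlaneRotatorMessagerMiracleSole.lean`). Everything is
PROVED from the tree; no definition, no named fact, no instance is introduced; the Fröhlich–Spencer named fact
`FrohlichSpencerPowerLawLowerBound` is used ONLY in the one corollary that carries its name.

Source of the architecture: D. van Engelenburg, M. Lis, Comm. Math. Phys. **399** (2023) 85 [VanEngelenburgLis2023], §6
(p. 13 of arXiv:2110.09465): with `Λ_n = [−n,n]²`, `a_n = ⟨σ_0σ̄_{(n,n)}⟩`, *«By rotation symmetry and the
Messager–Miracle-Sole inequality, `a_n = min_{v∈∂Λ_n}⟨σ_0σ̄_v⟩ = max_{v∈∂Λ'_n}⟨σ_0σ̄_v⟩`. For `β ≥ β_c` we moreover have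
`∑_{w∈∂Λ'_n}⟨σ_0σ̄_w⟩ ≥ φ_{Λ'_n,β} ≥ 1`. These two observations together imply that for any `v ∈ ∂Λ_n`,
`⟨σ_0σ̄_v⟩_{ℤ²,β} ≥ a_n ≥ 1/|∂Λ'_n| = 1/(8n) ≥ 1/(8|v|)`, which implies (ii)»* of their Theorem 1: *«for all `β ≥ β_c`
and all distinct `v, v' ∈ ℤ²`, `⟨σ_vσ̄_{v'}⟩_{ℤ²,β} ≥ 1/(8|v − v'|)`»*; and *«there is no other behaviour than exponential
and power-law decay»*. Here `β_c` is characterised by non-summability (the tree's `susceptibilityCriticalCoupling`); that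
`β_c < ∞` (a Kosterlitz–Thouless phase exists) is the Fröhlich–Spencer / Lammers input which this file does NOT use.

* §1 (every `ν ≥ 1`, `K ≥ 0`) **lattice symmetries and the axis sandwich**: `G_K(0, |x|) = G_K(0, x)`, transpositions,
  `G_K(0, c·eᵢ) = G_K(0, c·e₀)`; zeroing non-negative coordinates raises `G` (Messager–Miracle-Solé along the axes);
  **`infTwoPoint_zero_le_single_supNorm`: `G_K(0, x) ≤ G_K(0, ‖x‖∞·e₀)`** (the axis carries the maximum of every
  `ℓ∞`-sphere); `infTwoPoint_zero_single_antitone`; iterated diagonal steps `infTwoPoint_zero_add_nsmul_diag_le`.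
* §2 (`ν = 2`) **`infTwoPoint_zero_single_l1Norm_le`: `G_K(0, ‖x‖₁·e₀) ≤ G_K(0, x)`**; the sphere-sum sandwich
  `8R·G_K(0, 2R·e₀) ≤ ∑_{‖b‖∞=R} G_K(0,b) ≤ 8R·G_K(0, R·e₀)` (`sum_sphere_two_infTwoPoint_le`,
  `card_mul_infTwoPoint_le_sum_sphere_two`; the upper bound `∑ ≤ |∂Λ_R|·G_K(0,R·e₀)` in every `ν`,
  `sum_sphere_infTwoPoint_le_card_mul`) — the levers for the cell's certificate engines on the XY two-point function itself.
* §3 (`ν = 2`, `K ≥ 0`) **non-summability forces the explicit power law**: `χ(K) = ∞ ⇒ ∑_{‖b‖∞=R}G ≥ 1` (Simon–Lieb,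
  tree) `⇒ G_K(0, R·e₀) ≥ 1/(8R)` `⇒` **`inv_le_infTwoPoint_of_not_summable`: `G_K(0, v) ≥ 1/(8‖v‖₁)` for all `v ≠ 0`**
  (and `≥ 1/(16‖v‖∞)`); the unconditional **dichotomy** `hasExponentialDecay_or_inv_le_infTwoPoint` (exponential decay
  or the explicit power law, at every `K ≥ 0`); the power law AT and above `K_χ(2)`
  (`inv_le_infTwoPoint_of_susceptibilityCriticalCoupling_le` — at `K = K_χ` the tree's Fröhlich–Spencer form is silent),
  wherever the helicity modulus is positive (`inv_le_infTwoPoint_of_torusXYStiffnessLiminf_pos`: `Υ_∞(K) > 0 ⇒ G ≥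
  1/(8‖v‖₁)`), and on the whole range of the Fröhlich–Spencer fact with explicit constants
  (`FrohlichSpencerPowerLawLowerBound.inv_le_infTwoPoint`).
* §4 (every `ν ≥ 1`, `K > 0`) **`massGap_eq_ofReal_invCorrLength`: `massGap K ν = invCorrLength G_K`** — the equality
  announced as NOT CLAIMED in `PlaneRotatorCorrelationLength.lean` (§6 there: `≤`; here `≥` via
  `infTwoPoint_zero_le_of_axis_bound`: every axis rate is an `ℓ∞` rate).

Constants: the printed bound is `1/(8|v|)` with `v ∈ ∂Λ_n` (`ℓ∞` radius) via the `ℓ¹`-ball `Λ'_n` form of Simon–Lieb;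
the tree's Simon–Lieb is the `ℓ∞`-box form, whence `1/(8‖v‖₁) ≥ 1/(16‖v‖∞)` here — same law, constant halved in the
`ℓ∞` reading, equal on the axes. WHAT THIS IS NOT: not `K_χ(2) < ∞` (Fröhlich–Spencer 1981 / Lammers 2022, the tree's
named fact); not the exponent `1/(2πβ')` of the spin-wave law; nothing about the Villain model, quantum models or the
Hubbard model; no number of record for the cell.

## References

* D. van Engelenburg, M. Lis, *An elementary proof of phase transition in the planar XY model*, Comm. Math. Phys. 399
  (2023) 85–104, arXiv:2110.09465: Theorem 1, §6, Lemma 21. [VanEngelenburgLis2023]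
* A. Messager, S. Miracle-Solé, C. Pfister, Comm. Math. Phys. 58 (1978) 19–29 (not held; cited through the former).
  [MessagerMiraclesolePfister1978]
* B. Simon, Comm. Math. Phys. 77 (1980) 111; E. H. Lieb, Comm. Math. Phys. 77 (1980) 127 (tree
  `summable_infTwoPoint_of_nnBoxShellSum_lt_one`, `nnBoxShellSum_le_sum_sphere_infTwoPoint`). [Simon1980CMP] [Lieb1980]
* S. Friedli, Y. Velenik, *Statistical Mechanics of Lattice Systems*, CUP 2017, §3.10.7 (correlation length along an
  axis). [FriedliVelenik2017]
* J. Fröhlich, T. Spencer, Comm. Math. Phys. 81 (1981) 527, Theorem C (the tree's named fact). [FrohlichSpencerKT1981]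
* J. Ginibre, Comm. Math. Phys. 16 (1970) 310 (lattice symmetries / monotonicity of the free state). [Ginibre1970]

## Tree anchors

`infTwoPoint_zero_add_single_le`, `infTwoPoint_zero_add_single_sub_single_le`, `infTwoPoint_zero_add_nsmul_single_antitone`
(companion file); `infTwoPoint_zero_signedPerm`, `Site.signedPerm_apply`; `sphere`, `mem_sphere`, `card_sphere_succ_add`,
`card_box`, `Site.supNorm_le_iff`, `Site.norm_eq_supNorm`, `l1Norm`; `summable_infTwoPoint_of_nnBoxShellSum_lt_one`,
`nnBoxShellSum_le_sum_sphere_infTwoPoint`, `hasExponentialDecay_infTwoPoint_of_summable`, `massGap`,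
`massGap_eq_zero_of_susceptibilityCriticalCoupling_le`, `massGap_eq_zero_iff_not_summable`, `massGap_le_ofReal_invCorrLength`,
`ofReal_le_massGap`, `neg_log_infTwoPoint_axis_div_mem_Icc`, `infTwoPoint_single_pos`,
`not_summable_infTwoPoint_of_torusXYStiffnessLiminf_pos`, `FrohlichSpencerPowerLawLowerBound.not_summable`. Mathlib:
`Finset.exists_mem_eq_sup`, `Finset.sum_le_card_nsmul`, `Finset.card_nsmul_le_sum`, `Filter.eventually_lt_of_lt_liminf`,
`le_of_forall_lt_imp_le_of_dense`, `ENNReal.lt_ofReal_iff_toReal_lt`.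
-/

noncomputable section

open MeasureTheory Finset Filter Topology
open scoped BigOperators ENNReal

namespace Literature.Probability.LatticeModels

namespace PlaneRotator

open Literature.Barriers.CriticalPhenomena Literature.Barriers.CriticalPhenomena.LongRangeIsing

variable [MeasurableSpace Circle] [BorelSpace Circle] {ν : ℕ}

/-! ## §1 Lattice symmetries of `G_K(0, ·)` and the axis comparisons in every dimension -/

/-- **Sign flips**: `G_K(0, x) = G_K(0, |x|)` (coordinatewise absolute value; a signed coordinate permutation).
[cite: Ginibre1970, Example 4 (plane rotators; lattice symmetries of the free state)] -/
theorem infTwoPoint_zero_abs (K : ℝ) (x : Site ν) :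
    infTwoPoint K ν 0 (fun j => |x j|) = infTwoPoint K ν 0 x := by
  have h := infTwoPoint_zero_signedPerm K (Equiv.refl (Fin ν)) (fun j => if 0 ≤ x j then 1 else -1) x
  have hx : Site.signedPerm (Equiv.refl (Fin ν)) (fun j => if 0 ≤ x j then 1 else -1) x = fun j => |x j| := by
    funext j
    rw [Site.signedPerm_apply, Equiv.refl_symm, Equiv.refl_apply]
    by_cases hj : 0 ≤ x j
    · simp only [if_pos hj, Units.val_one, one_mul, abs_of_nonneg hj]
    · simp only [if_neg hj, Units.val_neg, Units.val_one, neg_one_mul, abs_of_neg (not_le.1 hj)]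
  rw [hx] at h
  exact h

/-- **Coordinate transpositions**: `G_K(0, x ∘ (i j)) = G_K(0, x)`. [cite: Ginibre1970, Example 4 (plane rotators; lattice symmetries of the free state)] -/
theorem infTwoPoint_zero_comp_swap (K : ℝ) (i j : Fin ν) (x : Site ν) :
    infTwoPoint K ν 0 (fun k => x (Equiv.swap i j k)) = infTwoPoint K ν 0 x := by
  have h := infTwoPoint_zero_signedPerm K (Equiv.swap i j) 1 x
  have hx : Site.signedPerm (Equiv.swap i j) 1 x = fun k => x (Equiv.swap i j k) := by
    funext k
    rw [Site.signedPerm_apply, Pi.one_apply, Units.val_one, one_mul, Equiv.symm_swap]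
  rw [hx] at h
  exact h

/-- **Axis relabelling**: `G_K(0, c·eᵢ) = G_K(0, c·e₀)`. [cite: Ginibre1970, Example 4 (plane rotators; lattice symmetries of the free state)] -/
theorem infTwoPoint_zero_single_eq_single_zero [NeZero ν] (K : ℝ) (i : Fin ν) (c : ℤ) :
    infTwoPoint K ν 0 (Pi.single i c) = infTwoPoint K ν 0 (Pi.single 0 c) := by
  have h := infTwoPoint_zero_comp_swap K 0 i (Pi.single i c)
  have hx : (fun k => (Pi.single i c : Site ν) (Equiv.swap (0 : Fin ν) i k)) = Pi.single 0 c := by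
    funext k
    by_cases hk : k = 0
    · subst hk
      rw [Equiv.swap_apply_left, Pi.single_eq_same, Pi.single_eq_same]
    · rw [Pi.single_eq_of_ne hk]
      by_cases hki : k = i
      · subst hki
        rw [Equiv.swap_apply_right, Pi.single_eq_of_ne (Ne.symm hk)]
      · rw [Equiv.swap_apply_of_ne_of_ne hk hki, Pi.single_eq_of_ne hki]
  rw [hx] at h
  exact h.symm

/-- **Zeroing a non-negative coordinate raises the two-point function**: `yᵢ ≥ 0 ⇒ G_K(0, y) ≤ G_K(0, y|_{yᵢ = 0})`
(Messager–Miracle-Solé monotonicity along the axis `i`, iterated `yᵢ` times).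
[cite: VanEngelenburgLis2023, Lemma 21 (monotonicity along lattice lines)] -/
theorem infTwoPoint_zero_le_update_zero {K : ℝ} (hK : 0 ≤ K) (y : Site ν) (i : Fin ν) (hy : 0 ≤ y i) :
    infTwoPoint K ν 0 y ≤ infTwoPoint K ν 0 (Function.update y i 0) := by
  have h0 : 0 ≤ (Function.update y i 0 : Site ν) i := by
    rw [Function.update_apply, if_pos rfl]
  have hmono : infTwoPoint K ν 0 (Function.update y i 0 + ((y i).toNat : ℤ) • Pi.single i (1 : ℤ)) ≤
      infTwoPoint K ν 0 (Function.update y i 0 + ((0 : ℕ) : ℤ) • Pi.single i (1 : ℤ)) :=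
    infTwoPoint_zero_add_nsmul_single_antitone hK i h0 (Nat.zero_le (y i).toNat)
  have e1 : (Function.update y i 0 : Site ν) + ((y i).toNat : ℤ) • Pi.single i (1 : ℤ) = y := by
    funext j
    rw [Pi.add_apply, Pi.smul_apply, Function.update_apply, smul_eq_mul]
    by_cases hj : j = i
    · subst hj
      rw [if_pos rfl, Pi.single_eq_same, mul_one, zero_add, Int.toNat_of_nonneg hy]
    · rw [if_neg hj, Pi.single_eq_of_ne hj, mul_zero, add_zero]
  have e2 : (Function.update y i 0 : Site ν) + ((0 : ℕ) : ℤ) • Pi.single i (1 : ℤ) = Function.update y i 0 := by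
    rw [Nat.cast_zero, zero_smul, add_zero]
  rw [e1, e2] at hmono
  exact hmono

/-- Zeroing any set of coordinates of a non-negative vector raises `G_K(0, ·)`.
[cite: VanEngelenburgLis2023, Lemma 21 (monotonicity along lattice lines)] -/
theorem infTwoPoint_zero_le_of_zeroOn {K : ℝ} (hK : 0 ≤ K) {y : Site ν} (hy : ∀ j, 0 ≤ y j)
    (S : Finset (Fin ν)) :
    infTwoPoint K ν 0 y ≤ infTwoPoint K ν 0 (fun j => if j ∈ S then 0 else y j) := by
  classical
  induction S using Finset.induction_on with
  | empty =>
    have e : (fun j => if j ∈ (∅ : Finset (Fin ν)) then (0 : ℤ) else y j) = y := by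
      funext j
      simp
    rw [e]
  | insert i S hi ih =>
    have hyi : 0 ≤ (fun j => if j ∈ S then (0 : ℤ) else y j) i := by
      show 0 ≤ (if i ∈ S then (0 : ℤ) else y i)
      rw [if_neg hi]
      exact hy i
    have hstep := infTwoPoint_zero_le_update_zero hK (fun j => if j ∈ S then (0 : ℤ) else y j) i hyi
    have e : Function.update (fun j => if j ∈ S then (0 : ℤ) else y j) i 0 =
        fun j => if j ∈ insert i S then (0 : ℤ) else y j := by
      funext j
      rw [Function.update_apply]
      by_cases hj : j = i
      · subst hj
        simp
      · simp [Finset.mem_insert, hj]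
    rw [e] at hstep
    exact ih.trans hstep

/-- **The axis dominates every ℓ∞-sphere**: `G_K(0, x) ≤ G_K(0, ‖x‖∞·e₀)` for all `x ∈ ℤ^ν` (`ν ≥ 1`, `K ≥ 0`) —
flip signs, zero all coordinates but one where `|xᵢ|` is maximal, relabel the axis.
[cite: VanEngelenburgLis2023, Lemma 21 and §6 («the largest correlation on a line is attained closest to 0»)] -/
theorem infTwoPoint_zero_le_single_supNorm [NeZero ν] {K : ℝ} (hK : 0 ≤ K) (x : Site ν) :
    infTwoPoint K ν 0 x ≤ infTwoPoint K ν 0 (Pi.single 0 (Site.supNorm x : ℤ)) := by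
  classical
  rw [← infTwoPoint_zero_abs K x]
  have hy0 : ∀ j, 0 ≤ (fun j => |x j|) j := fun j => abs_nonneg _
  obtain ⟨i₀, -, hi₀⟩ := Finset.exists_mem_eq_sup (Finset.univ : Finset (Fin ν)) Finset.univ_nonempty
    (fun i => (x i).natAbs)
  have hsup : (Site.supNorm x : ℤ) = |x i₀| := by
    unfold Site.supNorm
    rw [hi₀, Int.natCast_natAbs]
  have h1 := infTwoPoint_zero_le_of_zeroOn hK hy0 (Finset.univ.erase i₀)
  have e : (fun j => if j ∈ Finset.univ.erase i₀ then (0 : ℤ) else (fun j => |x j|) j) = Pi.single i₀ |x i₀| := by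
    funext j
    by_cases hj : j = i₀
    · subst hj
      simp
    · simp [Finset.mem_erase, hj]
  rw [e, infTwoPoint_zero_single_eq_single_zero K i₀] at h1
  rw [hsup]
  exact h1

/-- Along the axis `n ↦ G_K(0, n·e₀)` is non-increasing. [cite: VanEngelenburgLis2023, Lemma 21] -/
theorem infTwoPoint_zero_single_antitone [NeZero ν] {K : ℝ} (hK : 0 ≤ K) :
    Antitone fun n : ℕ => infTwoPoint K ν 0 (Pi.single 0 (n : ℤ)) := by
  have h := infTwoPoint_zero_add_nsmul_single_antitone hK (0 : Fin ν) (x := 0) (le_refl _)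
  have e : ∀ n : ℕ, ((0 : Site ν) + (n : ℤ) • Pi.single (0 : Fin ν) (1 : ℤ)) = Pi.single 0 (n : ℤ) := fun n => by
    rw [zero_add, ← Pi.single_smul, smul_eq_mul, mul_one]
  intro m n hmn
  have h' : infTwoPoint K ν 0 ((0 : Site ν) + (n : ℤ) • Pi.single (0 : Fin ν) (1 : ℤ)) ≤
      infTwoPoint K ν 0 ((0 : Site ν) + (m : ℤ) • Pi.single (0 : Fin ν) (1 : ℤ)) := h hmn
  rwa [e, e] at h'

/-- **Iterated diagonal steps**: for `i ≠ j` and `xⱼ ≤ xᵢ`, `G_K(0, x + m(eᵢ − eⱼ)) ≤ G_K(0, x)` for every `m ∈ ℕ`.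
[cite: VanEngelenburgLis2023, Lemma 21 (the diagonal sequence)] -/
theorem infTwoPoint_zero_add_nsmul_diag_le {K : ℝ} (hK : 0 ≤ K) {i j : Fin ν} (hij : i ≠ j) {x : Site ν}
    (hx : x j ≤ x i) (m : ℕ) :
    infTwoPoint K ν 0 (x + (m : ℤ) • (Pi.single i 1 - Pi.single j 1)) ≤ infTwoPoint K ν 0 x := by
  induction m with
  | zero => simp
  | succ m ih =>
    have hx' : (x + (m : ℤ) • (Pi.single i (1 : ℤ) - Pi.single j 1) : Site ν) j ≤
        (x + (m : ℤ) • (Pi.single i (1 : ℤ) - Pi.single j 1) : Site ν) i := by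
      simp only [Pi.add_apply, Pi.smul_apply, Pi.sub_apply, Pi.single_eq_same, Pi.single_eq_of_ne hij,
        Pi.single_eq_of_ne (Ne.symm hij), smul_eq_mul]
      have : (0 : ℤ) ≤ m := Nat.cast_nonneg m
      nlinarith
    have hstep := infTwoPoint_zero_add_single_sub_single_le hK hij hx'
    have e : (x + ((m + 1 : ℕ) : ℤ) • (Pi.single i (1 : ℤ) - Pi.single j 1) : Site ν) =
        x + (m : ℤ) • (Pi.single i (1 : ℤ) - Pi.single j 1) + Pi.single i 1 - Pi.single j 1 := by
      rw [Nat.cast_succ, add_smul, one_smul]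
      abel
    rw [e]
    exact hstep.trans ih

/-! ## §2 The square lattice: the `ℓ¹` axis point is dominated, sphere sums -/

section Square

omit [MeasurableSpace Circle] [BorelSpace Circle] in
/-- `‖x‖₁ = |x₀| + |x₁|` on `ℤ²`. [folklore] -/
private theorem l1Norm_two (x : Site 2) : (l1Norm x : ℤ) = |x 0| + |x 1| := by
  unfold l1Norm
  rw [Fin.sum_univ_two, Nat.cast_add, Int.natCast_natAbs, Int.natCast_natAbs]

/-- **The `ℓ¹` axis point is dominated**: `G_K(0, ‖x‖₁·e₀) ≤ G_K(0, x)` on `ℤ²` (`K ≥ 0`) — flip signs, order the two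
coordinates, then move the smaller one onto the larger by diagonal steps. [cite: VanEngelenburgLis2023, Lemma 21 and §6] -/
theorem infTwoPoint_zero_single_l1Norm_le {K : ℝ} (hK : 0 ≤ K) (x : Site 2) :
    infTwoPoint K 2 0 (Pi.single 0 (l1Norm x : ℤ)) ≤ infTwoPoint K 2 0 x := by
  -- reduce to non-negative coordinates `(a, c)` with `c ≤ a`
  suffices key : ∀ y : Site 2, 0 ≤ y 1 → y 1 ≤ y 0 →
      infTwoPoint K 2 0 (Pi.single 0 (y 0 + y 1)) ≤ infTwoPoint K 2 0 y by
    rw [← infTwoPoint_zero_abs K x, l1Norm_two]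
    by_cases h : |x 1| ≤ |x 0|
    · exact key (fun j => |x j|) (abs_nonneg _) h
    · have h' : |x 0| ≤ |x 1| := le_of_not_ge h
      rw [← infTwoPoint_zero_comp_swap K 0 1 (fun j => |x j|)]
      have := key (fun k => |x (Equiv.swap (0 : Fin 2) 1 k)|) (abs_nonneg _)
        (by simpa [Equiv.swap_apply_left, Equiv.swap_apply_right] using h')
      simpa [Equiv.swap_apply_left, Equiv.swap_apply_right, add_comm] using this
  intro y hy1 hy10
  have h01 : (0 : Fin 2) ≠ 1 := by decide
  have h := infTwoPoint_zero_add_nsmul_diag_le hK h01 hy10 (y 1).toNat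
  have e : (y + ((y 1).toNat : ℤ) • (Pi.single (0 : Fin 2) (1 : ℤ) - Pi.single 1 1) : Site 2) = Pi.single 0 (y 0 + y 1) := by
    rw [Int.toNat_of_nonneg hy1]
    funext k
    fin_cases k
    · simp
    · simp
  rw [e] at h
  exact h

omit [MeasurableSpace Circle] [BorelSpace Circle] in
/-- `|∂Λ_R| = 8R` on `ℤ²` (`R ≥ 1`). [folklore] -/
private theorem card_sphere_two {R : ℕ} (hR : 1 ≤ R) : #(sphere 2 R) = 8 * R := by
  obtain ⟨k, rfl⟩ : ∃ k, R = k + 1 := ⟨R - 1, by omega⟩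
  have h := card_sphere_succ_add (d := 2) k
  rw [card_box, card_box] at h
  have e : (2 * (k + 1) + 1) ^ 2 = 8 * (k + 1) + (2 * k + 1) ^ 2 := by ring
  rw [e] at h
  exact Nat.add_right_cancel h

/-- **Sphere sums are dominated by the axis** (every `ν ≥ 1`): `∑_{‖b‖∞ = R} G_K(0, b) ≤ |∂Λ_R| · G_K(0, R·e₀)`.
[cite: VanEngelenburgLis2023, §6 (a_n = min over ∂Λ_n / max over ∂Λ'_n)] -/
theorem sum_sphere_infTwoPoint_le_card_mul [NeZero ν] {K : ℝ} (hK : 0 ≤ K) (R : ℕ) :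
    ∑ b ∈ sphere ν R, infTwoPoint K ν 0 b ≤ #(sphere ν R) * infTwoPoint K ν 0 (Pi.single 0 (R : ℤ)) := by
  have h : ∀ b ∈ sphere ν R, infTwoPoint K ν 0 b ≤ infTwoPoint K ν 0 (Pi.single 0 (R : ℤ)) := fun b hb => by
    have h1 := infTwoPoint_zero_le_single_supNorm hK b
    rwa [mem_sphere.1 hb] at h1
  have := Finset.sum_le_card_nsmul _ _ _ h
  rwa [nsmul_eq_mul] at this

/-- **Sphere sandwich on `ℤ²`**: `∑_{‖b‖∞ = R} G_K(0, b) ≤ 8R · G_K(0, R·e₀)` (`R ≥ 1`).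
[cite: VanEngelenburgLis2023, §6] -/
theorem sum_sphere_two_infTwoPoint_le {K : ℝ} (hK : 0 ≤ K) {R : ℕ} (hR : 1 ≤ R) :
    ∑ b ∈ sphere 2 R, infTwoPoint K 2 0 b ≤ 8 * R * infTwoPoint K 2 0 (Pi.single 0 (R : ℤ)) := by
  have h := sum_sphere_infTwoPoint_le_card_mul (ν := 2) hK R
  rw [card_sphere_two hR] at h
  push_cast at h
  exact h

/-- … and from below: `8R · G_K(0, 2R·e₀) ≤ ∑_{‖b‖∞ = R} G_K(0, b)` (`‖b‖₁ ≤ 2R` on the sphere, then the axis is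
non-increasing). [cite: VanEngelenburgLis2023, §6] -/
theorem card_mul_infTwoPoint_le_sum_sphere_two {K : ℝ} (hK : 0 ≤ K) {R : ℕ} (hR : 1 ≤ R) :
    8 * R * infTwoPoint K 2 0 (Pi.single 0 ((2 * R : ℕ) : ℤ)) ≤ ∑ b ∈ sphere 2 R, infTwoPoint K 2 0 b := by
  have h : ∀ b ∈ sphere 2 R, infTwoPoint K 2 0 (Pi.single 0 ((2 * R : ℕ) : ℤ)) ≤ infTwoPoint K 2 0 b := by
    intro b hb
    have hb' := mem_sphere.1 hb
    have hl1 : l1Norm b ≤ 2 * R := by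
      have h0 : (b 0).natAbs ≤ R := by rw [← hb']; exact Site.supNorm_le_iff.1 le_rfl 0
      have h1 : (b 1).natAbs ≤ R := by rw [← hb']; exact Site.supNorm_le_iff.1 le_rfl 1
      unfold l1Norm
      rw [Fin.sum_univ_two]
      omega
    exact ((infTwoPoint_zero_single_antitone (ν := 2) hK) hl1).trans (infTwoPoint_zero_single_l1Norm_le hK b)
  have := Finset.card_nsmul_le_sum _ _ _ h
  rwa [card_sphere_two hR, nsmul_eq_mul, Nat.cast_mul, Nat.cast_ofNat] at this

/-! ## §3 Infinite susceptibility forces an explicit power law (van Engelenburg–Lis §6, without Fröhlich–Spencer) -/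

/-- **`χ(K) = ∞` ⇒ every sphere sum is at least one** on `ℤ²` (`K ≥ 0`): otherwise Lieb's box terminates
(`S_R(K) ≤ ∑_{‖b‖∞=R} G_K(0,b) < 1`) and the susceptibility is finite. [cite: VanEngelenburgLis2023, §6 (φ_{G,β} ≥ 1 for β ≥ β_c)] [cite: Lieb1980, p. 128 (φ(β) < 1 for a box)] -/
theorem one_le_sum_sphere_infTwoPoint_of_not_summable {K : ℝ} (hK : 0 ≤ K)
    (hG : ¬ Summable fun x : Site 2 => infTwoPoint K 2 0 x) {R : ℕ} (hR : 1 ≤ R) :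
    1 ≤ ∑ b ∈ sphere 2 R, infTwoPoint K 2 0 b := by
  by_contra hlt
  rw [not_le] at hlt
  exact hG (summable_infTwoPoint_of_nnBoxShellSum_lt_one hK hR
    ((nnBoxShellSum_le_sum_sphere_infTwoPoint hK R).trans_lt hlt)).1

/-- **`χ(K) = ∞` ⇒ `G_K(0, R·e₀) ≥ 1/(8R)`** for every `R ≥ 1` (the axis carries the largest correlation on the sphere
`∂Λ_R`, `|∂Λ_R| = 8R`). [cite: VanEngelenburgLis2023, Theorem 1 (ii) and §6 (a_n ≥ 1/(8n))] -/
theorem inv_le_infTwoPoint_single_of_not_summable {K : ℝ} (hK : 0 ≤ K)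
    (hG : ¬ Summable fun x : Site 2 => infTwoPoint K 2 0 x) {R : ℕ} (hR : 1 ≤ R) :
    1 / (8 * R) ≤ infTwoPoint K 2 0 (Pi.single 0 (R : ℤ)) := by
  have h1 := one_le_sum_sphere_infTwoPoint_of_not_summable hK hG hR
  have h2 := sum_sphere_two_infTwoPoint_le hK hR
  have hR' : (0 : ℝ) < 8 * R := by
    have : (1 : ℝ) ≤ R := by exact_mod_cast hR
    linarith
  rw [div_le_iff₀ hR']
  linarith

/-- **`χ(K) = ∞` ⇒ `G_K(0, v) ≥ 1/(8‖v‖₁)` for every `v ≠ 0`** — the explicit power-law lower bound of van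
Engelenburg–Lis for the nearest-neighbour plane rotator on `ℤ²` at every coupling with infinite susceptibility, here
WITHOUT any input on where that phase is (in particular without the Fröhlich–Spencer theorem): Messager–Miracle-Solé +
Simon–Lieb. (The printed constant is `1/(8|v|)` with the `ℓ∞` radius of `∂Λ_n ∋ v` via the `ℓ¹`-ball version of
Simon–Lieb; with the tree's box version the `ℓ¹` norm appears, `‖v‖∞ ≤ ‖v‖₁ ≤ 2‖v‖∞`.)
[cite: VanEngelenburgLis2023, Theorem 1 (ii) with §6] -/
theorem inv_le_infTwoPoint_of_not_summable {K : ℝ} (hK : 0 ≤ K)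
    (hG : ¬ Summable fun x : Site 2 => infTwoPoint K 2 0 x) {v : Site 2} (hv : v ≠ 0) :
    1 / (8 * l1Norm v) ≤ infTwoPoint K 2 0 v := by
  have hl1 : 1 ≤ l1Norm v := by
    by_contra h
    apply hv
    have h0 : l1Norm v = 0 := by omega
    unfold l1Norm at h0
    funext i
    have := (Finset.sum_eq_zero_iff.1 h0) i (Finset.mem_univ i)
    exact Int.natAbs_eq_zero.1 this
  exact (inv_le_infTwoPoint_single_of_not_summable hK hG hl1).trans (infTwoPoint_zero_single_l1Norm_le hK v)

/-- The same in the `ℓ∞` norm: `χ(K) = ∞ ⇒ G_K(0, v) ≥ 1/(16‖v‖∞)` (`‖v‖₁ ≤ 2‖v‖∞` on `ℤ²`).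
[cite: VanEngelenburgLis2023, Theorem 1 (ii) with §6] -/
theorem inv_le_infTwoPoint_of_not_summable_supNorm {K : ℝ} (hK : 0 ≤ K)
    (hG : ¬ Summable fun x : Site 2 => infTwoPoint K 2 0 x) {v : Site 2} (hv : v ≠ 0) :
    1 / (16 * Site.supNorm v) ≤ infTwoPoint K 2 0 v := by
  have h := inv_le_infTwoPoint_of_not_summable hK hG hv
  have hl1 : l1Norm v ≤ 2 * Site.supNorm v := by
    have h0 : (v 0).natAbs ≤ Site.supNorm v := Site.supNorm_le_iff.1 le_rfl 0
    have h1 : (v 1).natAbs ≤ Site.supNorm v := Site.supNorm_le_iff.1 le_rfl 1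
    unfold l1Norm
    rw [Fin.sum_univ_two]
    omega
  have hl1' : (1 : ℝ) ≤ l1Norm v := by
    have : l1Norm v ≠ 0 := by
      intro h0; apply hv; funext i
      exact Int.natAbs_eq_zero.1 ((Finset.sum_eq_zero_iff.1 h0) i (Finset.mem_univ i))
    exact_mod_cast Nat.one_le_iff_ne_zero.2 this
  calc (1 : ℝ) / (16 * Site.supNorm v) ≤ 1 / (8 * l1Norm v) := by
        apply one_div_le_one_div_of_le (by linarith)
        have : (l1Norm v : ℝ) ≤ 2 * Site.supNorm v := by exact_mod_cast hl1
        linarith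
    _ ≤ infTwoPoint K 2 0 v := h

/-- **Dichotomy (sharpness of the decay) for the 2D plane rotator**: at every coupling `K ≥ 0` the free-state two-point
function EITHER decays exponentially OR obeys the explicit power-law lower bound `G_K(0, v) ≥ 1/(8‖v‖₁)` for all
`v ≠ 0` — «there is no other behaviour than exponential and power-law decay» (van Engelenburg–Lis, Theorem 1), here as an
unconditional kernel statement; which alternative holds is decided by the susceptibility (`K < K_χ` / `K ≥ K_χ`), and
that `K_χ < ∞` is the Fröhlich–Spencer / Lammers input not used here. [cite: VanEngelenburgLis2023, Theorem 1 and §6] -/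
theorem hasExponentialDecay_or_inv_le_infTwoPoint {K : ℝ} (hK : 0 ≤ K) :
    HasExponentialDecay (fun x : Site 2 => infTwoPoint K 2 0 x) ∨
      ∀ v : Site 2, v ≠ 0 → 1 / (8 * l1Norm v) ≤ infTwoPoint K 2 0 v := by
  by_cases hG : Summable fun x : Site 2 => infTwoPoint K 2 0 x
  · exact Or.inl (hasExponentialDecay_infTwoPoint_of_summable hK hG)
  · exact Or.inr fun v hv => inv_le_infTwoPoint_of_not_summable hK hG hv

/-- **At and above the susceptibility transition the power law is explicit**: if `K_χ(2) ≤ K` (`K ≥ 0`, so in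
particular `K_χ(2) < ∞`) then `G_K(0, v) ≥ 1/(8‖v‖₁)` for all `v ≠ 0` — including AT `K = K_χ(2)` itself, where the
tree's Fröhlich–Spencer form (`∃ K₁`, non-explicit constants) is silent. [cite: VanEngelenburgLis2023, Theorem 1 (ii)] -/
theorem inv_le_infTwoPoint_of_susceptibilityCriticalCoupling_le {K : ℝ} (hK : 0 ≤ K)
    (h : susceptibilityCriticalCoupling 2 ≤ ENNReal.ofReal K) {v : Site 2} (hv : v ≠ 0) :
    1 / (8 * l1Norm v) ≤ infTwoPoint K 2 0 v :=
  inv_le_infTwoPoint_of_not_summable hK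
    ((massGap_eq_zero_iff_not_summable hK).1 (massGap_eq_zero_of_susceptibilityCriticalCoupling_le hK h)) hv

/-- **A positive helicity modulus forces the explicit power law**: `Υ_∞(K) > 0 ⇒ G_K(0, v) ≥ 1/(8‖v‖₁)` for all
`v ≠ 0` (the stiffness onset lies at or below the susceptibility divergence, tree
`not_summable_infTwoPoint_of_torusXYStiffnessLiminf_pos`). [cite: VanEngelenburgLis2023, Theorem 1 (ii)] -/
theorem inv_le_infTwoPoint_of_torusXYStiffnessLiminf_pos {K : ℝ} (hK : 0 ≤ K) (h : 0 < torusXYStiffnessLiminf K)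
    {v : Site 2} (hv : v ≠ 0) : 1 / (8 * l1Norm v) ≤ infTwoPoint K 2 0 v :=
  inv_le_infTwoPoint_of_not_summable hK (not_summable_infTwoPoint_of_torusXYStiffnessLiminf_pos hK h) hv

/-- **Under Fröhlich–Spencer's Theorem C** (the tree's named fact): on its whole range `K ≥ K₁` the two-point function
obeys the EXPLICIT bound `G_K(0, v) ≥ 1/(8‖v‖₁)`, `v ≠ 0`. [cite: FrohlichSpencerKT1981, §1.4 Theorem C (p. 534)] [cite: VanEngelenburgLis2023, Theorem 1 (ii)] -/
theorem FrohlichSpencerPowerLawLowerBound.inv_le_infTwoPoint (hFS : FrohlichSpencerPowerLawLowerBound) :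
    ∃ K₁ : ℝ, 0 < K₁ ∧ ∀ K : ℝ, K₁ ≤ K → ∀ v : Site 2, v ≠ 0 → 1 / (8 * l1Norm v) ≤ infTwoPoint K 2 0 v := by
  obtain ⟨K₁, hK₁, h⟩ := hFS.not_summable
  exact ⟨K₁, hK₁, fun K hK v hv => inv_le_infTwoPoint_of_not_summable (hK₁.le.trans hK) (h K hK) hv⟩

end Square

/-! ## §4 The mass gap IS the axis inverse correlation length -/

section MassGap

/-- **Every axis rate is an `ℓ∞` rate** (`K ≥ 0`, `ν ≥ 1`): if `G_K(0, n·e₀) ≤ C e^{−mn}` for all `n` then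
`G_K(0, x) ≤ C e^{−m‖x‖∞}` for all `x` — the Messager–Miracle-Solé input the tree's `massGap_le_ofReal_invCorrLength`
was waiting for. [cite: FriedliVelenik2017, §3.10.7 (correlation length along an axis)] -/
theorem infTwoPoint_zero_le_of_axis_bound [NeZero ν] {K : ℝ} (hK : 0 ≤ K) {C m : ℝ}
    (h : ∀ n : ℕ, infTwoPoint K ν 0 (Pi.single 0 (n : ℤ)) ≤ C * Real.exp (-m * n)) (x : Site ν) :
    infTwoPoint K ν 0 x ≤ C * Real.exp (-m * ‖x‖) := by
  rw [Site.norm_eq_supNorm]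
  exact (infTwoPoint_zero_le_single_supNorm hK x).trans (h (Site.supNorm x))

/-- **`invCorrLength G_K ≤ massGap K ν`** (`K > 0`, `ν ≥ 1`): every `m` below the axis `liminf` of `−log G_K(0, n·e₀)/n`
is an `ℓ∞` exponential decay rate (eventual axis bound, finitely many exceptions absorbed in the constant, then the
Messager–Miracle-Solé axis dominance). [cite: FriedliVelenik2017, §3.10.7 (correlation length along an axis); Simon1980CMP, Thm 1.3] -/
theorem ofReal_invCorrLength_le_massGap [NeZero ν] {K : ℝ} (hK : 0 < K) :
    ENNReal.ofReal (invCorrLength fun x : Site ν => infTwoPoint K ν 0 x) ≤ massGap K ν := by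
  set L := invCorrLength fun x : Site ν => infTwoPoint K ν 0 x with hL
  -- every `0 < m < L` is an `ℓ∞` decay rate
  have hrate : ∀ m : ℝ, 0 < m → m < L →
      HasExponentialDecayRate (fun x : Site ν => infTwoPoint K ν 0 x) m := by
    intro m hm0 hmL
    have hbdd : IsBoundedUnder (· ≥ ·) atTop (fun n : ℕ =>
        -Real.log |infTwoPoint K ν 0 ((n : ℤ) • Pi.single (0 : Fin ν) (1 : ℤ))| / n) :=
      isBoundedUnder_of ⟨0, fun n => (neg_log_infTwoPoint_axis_div_mem_Icc hK n).1⟩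
    have hev : ∀ᶠ n : ℕ in atTop,
        m < -Real.log |infTwoPoint K ν 0 ((n : ℤ) • Pi.single (0 : Fin ν) (1 : ℤ))| / n := by
      rw [hL, invCorrLength] at hmL
      exact eventually_lt_of_lt_liminf hmL hbdd
    obtain ⟨N, hN⟩ := eventually_atTop.1 hev
    have hsingle : ∀ n : ℕ, ((n : ℤ) • Pi.single (0 : Fin ν) (1 : ℤ) : Site ν) = Pi.single 0 (n : ℤ) := fun n => by
      rw [← Pi.single_smul, smul_eq_mul, mul_one]
    -- eventual axis bound
    have hge : ∀ n : ℕ, N ≤ n → infTwoPoint K ν 0 (Pi.single 0 (n : ℤ)) ≤ Real.exp (-m * n) := by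
      intro n hn
      have hpos : 0 < infTwoPoint K ν 0 (Pi.single 0 (n : ℤ)) := infTwoPoint_single_pos hK 0 n
      have h1 := hN n hn
      rw [hsingle, abs_of_nonneg hpos.le] at h1
      rcases Nat.eq_zero_or_pos n with hn0 | hn0
      · subst hn0
        simp only [Nat.cast_zero, mul_zero, Real.exp_zero]
        exact infTwoPoint_le_one K 0 _
      · have hn' : (0 : ℝ) < n := by exact_mod_cast hn0
        rw [lt_div_iff₀ hn'] at h1
        -- m n < -log G  ⇒  G < exp(-m n)
        have h2 : Real.log (infTwoPoint K ν 0 (Pi.single 0 (n : ℤ))) < -m * n := by linarith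
        exact ((Real.log_lt_iff_lt_exp hpos).1 h2).le
    -- all `n`, with the constant `e^{mN}`
    have hall : ∀ n : ℕ, infTwoPoint K ν 0 (Pi.single 0 (n : ℤ)) ≤ Real.exp (m * N) * Real.exp (-m * n) := by
      intro n
      by_cases hn : N ≤ n
      · refine (hge n hn).trans ?_
        have : (1 : ℝ) ≤ Real.exp (m * N) := Real.one_le_exp (by positivity)
        nlinarith [Real.exp_pos (-m * n)]
      · have hnN : (n : ℝ) ≤ N := by exact_mod_cast (not_le.1 hn).le
        calc infTwoPoint K ν 0 (Pi.single 0 (n : ℤ)) ≤ 1 := infTwoPoint_le_one K 0 _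
          _ ≤ Real.exp (m * N) * Real.exp (-m * n) := by
            rw [← Real.exp_add]
            exact Real.one_le_exp (by nlinarith)
    refine ⟨hm0, Real.exp (m * N), fun x => ?_⟩
    rw [abs_of_nonneg (infTwoPoint_nonneg hK.le 0 x)]
    exact infTwoPoint_zero_le_of_axis_bound hK.le hall x
  -- conclude by density
  refine le_of_forall_lt_imp_le_of_dense fun r hr => ?_
  have hr' : r ≠ ⊤ := ne_top_of_lt hr
  have hrL : r.toReal < L := (ENNReal.lt_ofReal_iff_toReal_lt hr').1 hr
  by_cases hr0 : r.toReal ≤ 0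
  · have : r = 0 := by
      rcases (ENNReal.toReal_eq_zero_iff r).1 (le_antisymm hr0 ENNReal.toReal_nonneg) with h | h
      · exact h
      · exact absurd h hr'
    rw [this]
    exact bot_le
  · rw [← ENNReal.ofReal_toReal hr']
    exact ofReal_le_massGap (hrate r.toReal (lt_of_not_ge hr0) hrL)

/-- **`massGap K ν = invCorrLength G_K`** (`K > 0`, `ν ≥ 1`): the direction-free `ℓ∞` mass gap of the comparison model
and the tree's axis inverse correlation length coincide — the equality announced as NOT CLAIMED in
`PlaneRotatorCorrelationLength.lean` (§6 there proves `≤`; Messager–Miracle-Solé gives `≥`). [cite: FriedliVelenik2017, §3.10.7 (correlation length along an axis); Simon1980CMP, Thm 1.3] -/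
theorem massGap_eq_ofReal_invCorrLength [NeZero ν] {K : ℝ} (hK : 0 < K) :
    massGap K ν = ENNReal.ofReal (invCorrLength fun x : Site ν => infTwoPoint K ν 0 x) :=
  le_antisymm (massGap_le_ofReal_invCorrLength hK) (ofReal_invCorrLength_le_massGap hK)

end MassGap

end PlaneRotator

end Literature.Probability.LatticeModels

end
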